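import Mathlib
import Summits.Ventures.PercRepro2.Defs
import Summits.Ventures.PercRepro2.Independence
import Summits.Ventures.PercRepro2.Graph
import Summits.Ventures.PercRepro2.Induced
import Summits.Ventures.PercRepro2.HullDefs
import Summits.Ventures.PercRepro2.HullFlip
import Summits.Ventures.PercRepro2.HullPieceFlip

/-!
# Admissible region flips: every valid local move of the (LOC0) line at once
(blind cell PercRepro2, night-4, 2026-08-23T23:1xZ)

For a colouring `ζ` with `o` on the BLUE side of `l`, a vertex set `S ⊆ B_side` with `o ∈ S` is
ADMISSIBLE (`Admissible`) when

* (V2) no BLUE edge joins `S` to `B_side ∖ S` (`S` is closed under blue adjacency inside the blue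
  side), and
* (V1) no RED edge joins `S` to `blueDel ζ l S` = the blue cluster of `l` after deleting every edge
  touching `S`.

Then the flip of every edge touching `S` (`flip ends S ζ`) is an exact transport:

* `cluster_flip_eq_union`: `C_R^{ζ′}(l) = C_R(l) ∪ S`;
* `cluster_blue_flip_eq_blueDel`: `C_B^{ζ′}(l) = blueDel ζ l S` (the hull and the core may shrink);
* `regionFlip_mem`: `o ∈ R_side(ζ′)` and `h ∉ H_l(ζ′)` for every `h ∉ H_l(ζ)` — the flip maps
  `M₀ = {h ∉ H_l, o ∈ B_side}` into `P₀ = {h ∉ H_l, o ∈ R_side}`, recolouring only edges that touch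
  `C_B(l)(ζ)` AND `C_R(l)(ζ′)` (the (LOC-sym) locality, `regionFlip_local`).

Two admissible regions are always available: the PIECE of `o` (`admissible_piece`; the flip is
mine-2's `pieceFlip_total`, here with the blue cluster of the image identified exactly) and the
whole blue side (`admissible_bside`, the same-hull region flip). Census (night-4, exact, own code,
`work/ruleD.py`): the least admissible region containing the blue component of `o` inside `B_side`
is valid on every one of the 114,984 configurations of the 5,633 `(l, h, o)` cases at `n = 6`; no
admissible-region rule tried is injective (collisions 2,384 cases, exactly as the piece flip) —
this file is the exact transport law, not the bijection.
-/

namespace Summit.Ventures.PercRepro2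

namespace Hull

variable {V : Type*} {E : Type*} {ends : E → Sym2 V} {ζ : Config E} {l o : V} {S : Set V}

/-- The piece of a blue-side vertex lies on the blue side (colour swap of `piece_subset_rside`). -/
lemma piece_subset_bside (ho : o ∈ bside ends ζ l) : piece ends ζ l o ⊆ bside ends ζ l := by
  have ho' : o ∈ rside ends (blue ζ) l := by rw [rside_blue]; exact ho
  have := piece_subset_rside ho'
  rwa [piece_blue, rside_blue] at this

/-! ## The deleted blue cluster and admissible regions -/

/-- The blue cluster of `l` after deleting every edge touching `S`. -/
noncomputable def blueDel (ends : E → Sym2 V) (ζ : Config E) (l : V) (S : Set V) : Set V :=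
  cluster ends (delConfig ends S (blue ζ)) l

/-- `S ⊆ B_side` is admissible: no blue edge from `S` to the rest of the blue side, no red edge from
`S` to the deleted blue cluster of `l`. -/
structure Admissible (ends : E → Sym2 V) (ζ : Config E) (l : V) (S : Set V) : Prop where
  subset : S ⊆ bside ends ζ l
  closed : ∀ {x y : V} {e : E}, x ∈ S → y ∈ bside ends ζ l → y ∉ S → ends e = s(x, y) →
    ζ e = true
  noRed : ∀ {x y : V} {e : E}, x ∈ S → y ∈ blueDel ends ζ l S → ends e = s(x, y) → ζ e = false

/-- The deleted blue cluster lies in the blue cluster. -/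
lemma blueDel_subset (ends : E → Sym2 V) (ζ : Config E) (l : V) (S : Set V) :
    blueDel ends ζ l S ⊆ cluster ends (blue ζ) l :=
  cluster_mono (fun e => by
    by_cases h : e ∈ touches ends S
    · rw [delConfig_apply_of_mem h]; exact Bool.false_le _
    · rw [delConfig_apply_of_notMem h]) l

/-- `l` is not in a subset of the blue side. -/
lemma l_notMem_of_subset_bside (hS : S ⊆ bside ends ζ l) : l ∉ S :=
  fun hl => (hS hl).2 (mem_cluster_self _ _ _)

/-- The deleted blue cluster avoids `S` (when `l ∉ S`): an open path never enters `S`. -/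
lemma blueDel_disjoint (hl : l ∉ S) {x : V} (hx : x ∈ blueDel ends ζ l S) : x ∉ S := by
  have key : x ∈ {u | u ∉ S} :=
    mem_of_conn_of_closed (ends := ends) (ω := delConfig ends S (blue ζ)) (S := {u | u ∉ S})
      (fun a ha b hab => by
        obtain ⟨_, e, he, hends⟩ := exists_edge_of_adj hab
        intro hb
        have ht : e ∈ touches ends S := mem_touches_of_ends hends (Or.inr hb)
        rw [delConfig_apply_of_mem ht] at he
        exact Bool.false_ne_true he) hl hx
  exact key

/-- The deleted blue cluster is closed under blue edges not touching `S`. -/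
lemma mem_blueDel_of_edge {x y : V} {e : E} (hx : x ∈ blueDel ends ζ l S)
    (he : ζ e = false) (ht : e ∉ touches ends S) (hends : ends e = s(x, y)) :
    y ∈ blueDel ends ζ l S := by
  have he' : delConfig ends S (blue ζ) e = true := by
    rw [delConfig_apply_of_notMem ht]; exact blue_eq_true_iff.2 he
  exact mem_cluster_of_edge hx he' hends

/-! ## The blue cluster of the image -/

/-- After the flip the blue cluster of `l` is exactly the deleted blue cluster. -/
theorem cluster_blue_flip_eq_blueDel (hA : Admissible ends ζ l S) :
    cluster ends (blue (flip ends S ζ)) l = blueDel ends ζ l S := by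
  have hl : l ∉ S := l_notMem_of_subset_bside hA.subset
  apply Set.Subset.antisymm
  · intro u hu
    refine mem_of_conn_of_closed (ends := ends) (ω := blue (flip ends S ζ))
      (S := blueDel ends ζ l S) ?_ (mem_cluster_self _ _ _) hu
    intro a ha b hab
    obtain ⟨_, e, he, hends⟩ := exists_edge_of_adj hab
    rw [blue_flip] at he
    by_cases ht : e ∈ touches ends S
    · -- the edge touches `S`; `a ∉ S`, so `b ∈ S`, and it is red in `ζ` — excluded by (V1)
      have haS : a ∉ S := blueDel_disjoint hl ha
      have hbS : b ∈ S := by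
        rcases (mem_touches_iff_of_ends hends).1 ht with h | h
        · exact absurd h haS
        · exact h
      rw [flip_apply_of_mem ht, blue_apply, Bool.not_not] at he
      exact absurd (hA.noRed hbS ha (ends_swap hends)) (by simp [he])
    · rw [flip_apply_of_notMem ht] at he
      exact mem_blueDel_of_edge ha (blue_eq_true_iff.1 he) ht hends
  · -- `delConfig S (blue ζ) ≤ blue (flip S ζ)`
    rw [blue_flip]
    exact cluster_mono (delConfig_le_flip S (blue ζ)) l

/-! ## The red cluster of the image -/

/-- No edge of the red cluster touches a subset of the blue side: `C_R(l) ∪ S` is closed under the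
red edges of the flip. -/
lemma cluster_flip_subset_union (hA : Admissible ends ζ l S) :
    cluster ends (flip ends S ζ) l ⊆ cluster ends ζ l ∪ S := by
  intro u hu
  refine mem_of_conn_of_closed (ends := ends) (ω := flip ends S ζ) (S := cluster ends ζ l ∪ S) ?_
    (Or.inl (mem_cluster_self _ _ _)) hu
  intro a ha b hab
  obtain ⟨_, e, he, hends⟩ := exists_edge_of_adj hab
  by_cases ht : e ∈ touches ends S
  · rw [flip_apply_of_mem ht] at he
    have heζ : ζ e = false := by cases h : ζ e <;> simp_all
    by_cases hbS : b ∈ S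
    · exact Or.inr hbS
    · have haS : a ∈ S := by
        rcases (mem_touches_iff_of_ends hends).1 ht with h | h
        · exact h
        · exact absurd h hbS
      -- `b` is blue-adjacent to `a ∈ S ⊆ C_B(l)`, so `b ∈ C_B(l) ∖ S`; by (V2) it is not on the blue
      -- side, hence in the core
      have hbB : b ∈ cluster ends (blue ζ) l :=
        mem_cluster_of_edge (hA.subset haS).1 (blue_eq_true_iff.2 heζ) hends
      by_cases hbR : b ∈ cluster ends ζ l
      · exact Or.inl hbR
      · exact absurd (hA.closed haS ⟨hbB, hbR⟩ hbS hends) (by rw [heζ]; exact Bool.false_ne_true)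
  · rw [flip_apply_of_notMem ht] at he
    rcases ha with ha | ha
    · exact Or.inl (mem_cluster_of_edge ha he hends)
    · exact absurd (mem_touches_of_ends hends (Or.inl ha)) ht

/-- The red cluster of `ζ` survives the flip (its edges do not touch `S ⊆ B_side`). -/
lemma cluster_subset_cluster_flip (hA : Admissible ends ζ l S) :
    cluster ends ζ l ⊆ cluster ends (flip ends S ζ) l := by
  intro u hu
  have key : u ∈ {x | x ∈ cluster ends ζ l ∧ x ∈ cluster ends (flip ends S ζ) l} := by
    refine mem_of_conn_of_closed (ends := ends) (ω := ζ) ?_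
      ⟨mem_cluster_self _ _ _, mem_cluster_self _ _ _⟩ hu
    rintro a ⟨haR, haR'⟩ b hab
    obtain ⟨_, e, he, hends⟩ := exists_edge_of_adj hab
    have hbR : b ∈ cluster ends ζ l := mem_cluster_of_edge haR he hends
    have ht : e ∉ touches ends S := fun h => by
      rcases (mem_touches_iff_of_ends hends).1 h with h | h
      · exact (hA.subset h).2 haR
      · exact (hA.subset h).2 hbR
    have he' : flip ends S ζ e = true := by rw [flip_apply_of_notMem ht]; exact he
    exact ⟨hbR, mem_cluster_of_edge haR' he' hends⟩
  exact key.2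

/-- Every vertex of an admissible region is red-connected to `l` after the flip: along a blue
`ζ`-walk from `l`, the region is entered only from the core (V2), through an edge that the flip
turns red. -/
lemma subset_cluster_flip (hA : Admissible ends ζ l S) :
    S ⊆ cluster ends (flip ends S ζ) l := by
  intro u hu
  have huB : u ∈ cluster ends (blue ζ) l := (hA.subset hu).1
  -- the closed set: blue-cluster vertices that are either off `S` or already red-connected
  have key : u ∈ {x | x ∈ cluster ends (blue ζ) l ∧ (x ∈ S → x ∈ cluster ends (flip ends S ζ) l)} := by
    refine mem_of_conn_of_closed (ends := ends) (ω := blue ζ) ?_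
      ⟨mem_cluster_self _ _ _, fun hl => absurd hl (l_notMem_of_subset_bside hA.subset)⟩ huB
    rintro a ⟨haB, haI⟩ b hab
    obtain ⟨_, e, he, hends⟩ := exists_edge_of_adj hab
    have heζ : ζ e = false := blue_eq_true_iff.1 he
    refine ⟨mem_cluster_of_edge haB he hends, fun hbS => ?_⟩
    have ht : e ∈ touches ends S := mem_touches_of_ends hends (Or.inr hbS)
    have he' : flip ends S ζ e = true := by
      rw [flip_apply_of_mem ht, heζ]; rfl
    by_cases haS : a ∈ S
    · exact mem_cluster_of_edge (haI haS) he' hends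
    · -- `a ∈ C_B(l) ∖ S` is blue-adjacent to `b ∈ S`: by (V2) `a` is not on the blue side, so it is
      -- in the core, hence red-connected to `l` before and after the flip
      have haR : a ∈ cluster ends ζ l := by
        by_contra haR
        exact absurd (hA.closed hbS ⟨haB, haR⟩ haS (ends_swap hends))
          (by rw [heζ]; exact Bool.false_ne_true)
      exact mem_cluster_of_edge (cluster_subset_cluster_flip hA haR) he' hends
  exact key.2 hu

/-- After the flip the red cluster of `l` is exactly `C_R(l) ∪ S`. -/
theorem cluster_flip_eq_union (hA : Admissible ends ζ l S) :
    cluster ends (flip ends S ζ) l = cluster ends ζ l ∪ S :=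
  Set.Subset.antisymm (cluster_flip_subset_union hA)
    (Set.union_subset (cluster_subset_cluster_flip hA) (subset_cluster_flip hA))

/-! ## The transport theorem -/

/-- **Admissible region flip**: for `o ∈ S` admissible and `h` outside the hull, the flipped
configuration has `o` on the red side and `h` still outside the hull. -/
theorem regionFlip_mem (hA : Admissible ends ζ l S) (ho : o ∈ S) {h : V}
    (hh : h ∉ hull ends ζ l) :
    o ∈ rside ends (flip ends S ζ) l ∧ h ∉ hull ends (flip ends S ζ) l := by
  have hl : l ∉ S := l_notMem_of_subset_bside hA.subset
  have hR := cluster_flip_eq_union hA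
  have hB := cluster_blue_flip_eq_blueDel hA
  refine ⟨⟨?_, ?_⟩, ?_⟩
  · rw [hR]; exact Or.inr ho
  · rw [hB]; exact fun hoB => blueDel_disjoint hl hoB ho
  · rintro (hhR | hhB)
    · rw [hR] at hhR
      rcases hhR with hhR | hhS
      · exact hh (Or.inl hhR)
      · exact hh (Or.inr (hA.subset hhS).1)
    · rw [hB] at hhB
      exact hh (Or.inr (blueDel_subset ends ζ l S hhB))

/-- The flip recolours only edges touching `S`, and `S` lies in the blue cluster of the source and
in the red cluster of the image: the (LOC-sym) locality on both sides. -/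
theorem regionFlip_local (hA : Admissible ends ζ l S) {e : E} (he : flip ends S ζ e ≠ ζ e) :
    e ∈ touches ends (cluster ends (blue ζ) l) ∧
      e ∈ touches ends (cluster ends (flip ends S ζ) l) := by
  have ht : e ∈ touches ends S := by
    by_contra ht
    exact he (flip_apply_of_notMem ht)
  obtain ⟨x, hx, y, hends⟩ := ht
  refine ⟨⟨x, (hA.subset hx).1, y, hends⟩, ⟨x, ?_, y, hends⟩⟩
  rw [cluster_flip_eq_union hA]
  exact Or.inr hx

/-! ## Two admissible regions: the piece of `o` and the whole blue side -/

/-- The piece of a blue-side vertex is admissible. -/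
theorem admissible_piece (ho : o ∈ bside ends ζ l) : Admissible ends ζ l (piece ends ζ l o) where
  subset := piece_subset_bside ho
  closed := fun {x y e} hx hy hyP hends =>
    absurd (mem_piece_of_edge hx (bside_subset_hull_sdiff_core ζ l (piece_subset_bside ho hx))
      (bside_subset_hull_sdiff_core ζ l hy) hends) hyP
  noRed := fun {x y e} hx hy hends => by
    have hl : l ∉ piece ends ζ l o := l_notMem_of_subset_bside (piece_subset_bside ho)
    have hyB : y ∈ cluster ends (blue ζ) l := blueDel_subset ends ζ l _ hy
    have hyP : y ∉ piece ends ζ l o := blueDel_disjoint hl hy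
    by_cases hyR : y ∈ cluster ends ζ l
    · exact edge_core_bside_blue ⟨hyR, hyB⟩ (piece_subset_bside ho hx) (ends_swap hends)
    · exact absurd (mem_piece_of_edge hx (bside_subset_hull_sdiff_core ζ l (piece_subset_bside ho hx))
        (bside_subset_hull_sdiff_core ζ l ⟨hyB, hyR⟩) hends) hyP

/-- The whole blue side is admissible (the same-hull region flip). -/
theorem admissible_bside : Admissible ends ζ l (bside ends ζ l) where
  subset := le_rfl
  closed := fun {x y e} _ hy hyS _ => absurd hy hyS
  noRed := fun {x y e} hx hy hends => by
    have hl : l ∉ bside ends ζ l := l_notMem_of_subset_bside le_rfl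
    have hyB : y ∈ cluster ends (blue ζ) l := blueDel_subset ends ζ l _ hy
    have hyS : y ∉ bside ends ζ l := blueDel_disjoint hl hy
    have hyR : y ∈ cluster ends ζ l := by
      by_contra hyR
      exact hyS ⟨hyB, hyR⟩
    exact edge_core_bside_blue ⟨hyR, hyB⟩ hx (ends_swap hends)

end Hull

end Summit.Ventures.PercRepro2
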